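import Summits.BirchSwinnertonDyer.BirchSwinnertonDyer.Theorems.KatoDescentPotSupersingularKummerTowerOrthogonalLocal
import Summits.BirchSwinnertonDyer.Rank1Residual.X11b.KummerLocalTorsionSaturation
import Summits.BirchSwinnertonDyer.Rank1Residual.X11b.PerfectPairingAnnihilators
import Summits.BirchSwinnertonDyer.Rank1Residual.X11b.LevelShiftMaps
import Literature.NumberTheory.GaloisCohomology.PairingTateDual
import HarnessLib

/-!
# The kernel of `ι_k : H¹(K_v, E[p^k]) → H¹(K_v, E[p^∞])` is ORTHOGONAL, under the local Tate pairing read through the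
# DESCENDED Weil pairing `E[p^k] × E[p^k] → μ_{p^j p^k}`, to every class `[p^j]_* ỹ` coming down from level `p^j p^k`
# (route `KatoDescentPotSupersingular` / `…Tame…`, crux M = stmt-BirchSwinnertonDyer-19196; route-free helper)

Seat `bsd-potss-rkm` g19 (prover; cell `bsd-potss`), item stmt-BirchSwinnertonDyer-19196 (`--supports … --as helper`; closes
nothing).  HONEST FRAMING: BSD is not proved by any of this; nothing is booked; theorems only (no definition, no named fact):
TOOL theorems of local Galois cohomology of elliptic curves.

## Why (brick (a) of crux M's level-0 ledger, step "L1-translation + `Z_K ⊆ {}^⊥B_K`" of memo `HOME/rkm/FINDING-19196-rkm-g18.md`)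

The sharp S-side count confines `loc_p` of the level-`p^k` lifts of Kato's `S(E[p^∞])` to `𝓚_k ∩ {}^⊥B_k`
(`B_k = loc_p (desc^♭)_* red_{p^k}(A)`) and reads the result in `H¹(ℚ_p, E[p^∞])`, i.e. modulo `Z_k = ker ι_k`; the count is SHARP
(part 33 `…KummerImagePrimaryCount`: `#ι_k(X)·#E(ℚ_p)[p^k] = #X` for `X ≥ Z_k`) exactly when `Z_k ≤ 𝓚_k ∩ {}^⊥B_k`.  `Z_k ≤ 𝓚_k` is
X11b's `ker_map_primaryInclusion_le_kummerLocalConditionAt`; this file proves `Z_k ≤ {}^⊥B_k`: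

* §1 `localTatePairingZMod_map_pairingDualIntertwining` — **the L1-translation for ANY `μ_N`-valued equivariant pairing `B`**
  (the tree's `PairingTateDual.localTerm_pairingDual` at the level of LOCAL classes; X11b's `localTatePairingZMod_map_weilDual` is
  the Weil case): `⟨a, (B^♭)_* b⟩_v = inv_v (a ∪_{B|Γ_v} b)` for `a ∈ H¹(K_v, M₁)`, `b ∈ H¹(K_v, M₂)`.
* §2 (any `K`-field `E` of characteristic `0`, any level `p^k`, shift `p^j`, level-`p^j p^k` Weil datum `e`)
  **`cupProduct_descend_eq_zero_of_mem_ker_map_primaryInclusion`**: for `z ∈ ker(H¹(Γ_E, E[p^k]) → H¹(Γ_E, E[p^∞]))` and every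
  `ỹ ∈ H¹(Γ_E, E[p^j p^k])`, **`z ∪_desc [p^j]_* ỹ = 0`**, PROVIDED `p^j` kills the `p`-power torsion of `E(E)` — `z = κ_{p^k}(t)` for a
  torsion point `t` (X11b `map_torsion_localKummerMap_eq_ker_map_primaryInclusion`), `t = τ + p^k R` with `τ` of `p`-power order
  (`exists_ppow_torsion_add_nsmul_of_isOfFinAddOrder`), `κ(p^k R) = 0`, and `κ(τ) = κ_{E,p^k}(Q)` with `p^k Q = τ`, `(p^j p^k) Q = p^j τ = 0`,
  so part 30's `cupProduct_descend_restrictField_localKummerClass_map_mulK_eq_zero` applies.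
* §3 (finite place `v` of a number field `K`, any additive `inv_v`) **`localTatePairingZMod_eq_zero_of_mem_ker_map_primaryInclusion`**:
  `⟨z, (desc^♭)_* [p^j]_* ỹ⟩_v = 0`; **`ker_map_primaryInclusion_le_annLeft`**: `ker ι_k ≤ {}^⊥Y` for every `Y` consisting of such classes,
  hence `ker ι_k ≤ 𝓚_v ⊓ {}^⊥Y` (`…_le_inf_annLeft`) — the hypothesis `hZ` of brick (a)'s count (part 32 `…KatoIsotropicCount`,
  `natCard_mul_relIndex_mul_relIndex_eq_natCard`).

References: J. S. Milne, *ADT* I §2 (local duality), §6 proof of Prop. 6.9 [MilneADT2006]; J. H. Silverman, *AEC* III.8.1 (e), VIII §2, X §4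
[SilvermanAEC2009]; K. Kato, Astérisque 295, proof of Prop. 14.16 (pp. 244–245) [Kato2004Asterisque]; R. Greenberg, LNM 1716 §5
[GreenbergLNM1716].
-/

-- the summit and its single problem are both named `BirchSwinnertonDyer` (registry layout D-0017)
set_option linter.dupNamespace false
set_option autoImplicit false

noncomputable section

open scoped Classical ContRepresentation NumberField
open CategoryTheory Function Field NumberField IsDedekindDomain WeierstrassCurve
open Literature.NumberTheory.GaloisRepresentations Literature.NumberTheory.EllipticCurves
open Literature.NumberTheory.GaloisRepresentations.DiscreteGaloisModule (mu MuCarrier pairing tateDualPairingLocal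
  localTatePairing localTatePairingZMod homOfIntertwining)
open Summit.BirchSwinnertonDyer.Rank1Residual.X11b.Levels Summit.BirchSwinnertonDyer.Rank1Residual.X11b.LocBridge
  Summit.BirchSwinnertonDyer.Rank1Residual.X11b.LevelKummer Summit.BirchSwinnertonDyer.Rank1Residual.X11b.FiniteDuality

-- Cup products need `LocallyCompactSpace Γ_E`: in characteristic `0` the compactness of `Γ_E` is the tree's global instance
-- `Field.absoluteGaloisGroup.instCompactSpace` (`GaloisRepresentations/AbsGaloisGroup.lean`); no local instance is declared.

universe u

namespace Summit.BirchSwinnertonDyer.BirchSwinnertonDyer.Theorems.KummerTowerOrthogonal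

/-! ## §1 The L1-translation for a general `μ_N`-valued pairing: `⟨a, (B^♭)_* b⟩_v = inv_v (a ∪_{B|Γ_v} b)` -/

section Translation

variable {K : Type u} [Field K] [NumberField K]
variable {M₁ : Type u} [AddCommGroup M₁] [TopologicalSpace M₁] [DiscreteTopology M₁] [Finite M₁]
variable {M₂ : Type u} [AddCommGroup M₂] [TopologicalSpace M₂] [DiscreteTopology M₂]
variable {ρ₁ : DiscreteGaloisModule K M₁} {ρ₂ : DiscreteGaloisModule K M₂} {N : ℕ}
variable {B : M₁ →+ M₂ →+ MuCarrier K N}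
variable (hB : ∀ (σ : absoluteGaloisGroup K) (x : M₁) (y : M₂), B (ρ₁ σ x) (ρ₂ σ y) = mu K N σ (B x y))

/-- **`a ∪_{ev} (B^♭|_{Γ_v})_* b = a ∪_{B|Γ_v} b` in `H²(K_v, μ_N)`** for LOCAL classes `a ∈ H¹(K_v, M₁)`, `b ∈ H¹(K_v, M₂)`: the
evaluation cup product of the local Tate pairing against the transport of `b` by the dual map `B^♭ : M₂ → M₁^D` of an equivariant
`μ_N`-valued pairing `B` is the cup product of `B` restricted to `Γ_{K_v}` (adjoint naturality `ContPairing.cupProduct_adjoint`; the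
tree's `cupProduct_pairing_eq_tateDualPairing` is the global case, X11b's `cupProduct_tateDualPairingLocal_map_weilDual` the Weil case).
[cite: MilneADT2006, Ch. I §6, proof of Prop. 6.9] [cite: NeukirchSchmidtWingberg2008, I §4 (1.4.2)] -/
theorem cupProduct_tateDualPairingLocal_map_pairingDualIntertwining (v : Place K) [CharZero (Place.Completion v)]
    (a : galoisCohomology (ρ₁.toLocal v) 1) (b : galoisCohomology (ρ₂.toLocal v) 1) :
    (tateDualPairingLocal ρ₁ N v).cupProduct a
        (galoisCohomology.map ((DiscreteGaloisModule.pairingDualIntertwining hB).restrictField (Place.Completion v)) 1 b) =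
      (pairing (ρ₁.toLocal v) (ρ₂.toLocal v) ((mu K N).toLocal v) B
        (fun σ x y => hB (absGaloisRestrict K (Place.Completion v) σ) x y)).cupProduct a b := by
  have h := ContPairing.cupProduct_adjoint (tateDualPairingLocal ρ₁ N v)
    (pairing (ρ₁.toLocal v) (ρ₂.toLocal v) ((mu K N).toLocal v) B
      (fun σ x y => hB (absGaloisRestrict K (Place.Completion v) σ) x y)) (𝟙 _)
    (homOfIntertwining ((DiscreteGaloisModule.pairingDualIntertwining hB).restrictField (Place.Completion v)))
    (fun _ _ => rfl) a b
  have h1 : (cohomologyMap (𝟙 (ρ₁.toLocal v).toTopRep) 1) a = a := by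
    rw [show cohomologyMap (𝟙 (ρ₁.toLocal v).toTopRep) 1 = 𝟙 _ from map_id_eq_id _ (fun _ => rfl) 1]
    rfl
  rw [h1] at h
  exact h.symm

/-- **The L1-translation: `⟨a, (B^♭|_{Γ_v})_* b⟩_v = inv_v (a ∪_{B|Γ_v} b)`** for local classes and any additive
`inv_v : H²(K_v, μ_N) → ℤ/N` (`localTatePairingZMod`, the pairing of the tree's Poitou–Tate / local-duality predicates).
[cite: MilneADT2006, Ch. I §6, proof of Prop. 6.9] -/
theorem localTatePairingZMod_map_pairingDualIntertwining (v : Place K) [CharZero (Place.Completion v)]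
    (inv : galoisCohomology ((mu K N).toLocal v) 2 →+ ZMod N)
    (a : galoisCohomology (ρ₁.toLocal v) 1) (b : galoisCohomology (ρ₂.toLocal v) 1) :
    localTatePairingZMod ρ₁ N v inv a
        (galoisCohomology.map ((DiscreteGaloisModule.pairingDualIntertwining hB).restrictField (Place.Completion v)) 1 b) =
      inv ((pairing (ρ₁.toLocal v) (ρ₂.toLocal v) ((mu K N).toLocal v) B
        (fun σ x y => hB (absGaloisRestrict K (Place.Completion v) σ) x y)).cupProduct a b) := by
  rw [DiscreteGaloisModule.localTatePairingZMod_apply, ← cupProduct_tateDualPairingLocal_map_pairingDualIntertwining]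
  rfl

end Translation

/-! ## §2 `ker ι_k ⊥_desc [p^j]_* H¹(Γ_E, E[p^j p^k])` over any `K`-field `E` of characteristic `0` -/

section Field

variable {K : Type u} [Field K] [CharZero K] (W : WeierstrassCurve K) [W.IsElliptic] (p k j : ℕ) [Fact p.Prime]
  (E : Type u) [Field E] [Algebra K E] [CharZero E]
  (e : geomTorsion W ((p ^ j * p ^ k : ℕ) : ℤ) → geomTorsion W ((p ^ j * p ^ k : ℕ) : ℤ) → AlgebraicClosure K)
  (hμ : ∀ S T, e S T ^ (p ^ j * p ^ k) = 1)
  (hadd₁ : ∀ S₁ S₂ T, e (S₁ + S₂) T = e S₁ T * e S₂ T)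
  (hadd₂ : ∀ S T₁ T₂, e S (T₁ + T₂) = e S T₁ * e S T₂)
  (hgal : ∀ (σ : absoluteGaloisGroup K) (S T : geomTorsion W ((p ^ j * p ^ k : ℕ) : ℤ)), σ • e S T = e (σ • S) (σ • T))

/-- **Torsion Kummer classes at level `p^k` are orthogonal, under the descended Weil pairing `E[p^k] × E[p^k] → μ_{p^j p^k}`, to
every class coming down from level `p^j p^k`.**  For a `K`-field `E` of characteristic `0` such that `p^j` kills the `p`-power
torsion of `E(E)`, every `z ∈ ker(H¹(Γ_E, E[p^k]) → H¹(Γ_E, E[p^∞]))` and every `ỹ ∈ H¹(Γ_E, E[p^j p^k])` satisfy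
**`z ∪_desc [p^j]_* ỹ = 0`** in `H²(Γ_E, μ_{p^j p^k})`: `z = κ_{p^k}(τ)` with `τ ∈ E(E)` of `p`-power order (X11b's torsion
description of `ker ι_k` plus the prime-to-`p` splitting), `κ_{p^k}(τ) = κ_{E,p^k}(Q)` with `p^k Q = τ`, `(p^j p^k) Q = p^j τ = 0`, and
part 30 (`cupProduct_descend_restrictField_localKummerClass_map_mulK_eq_zero`).
[cite: MilneADT2006, Ch. I §6, proof of Prop. 6.9] [cite: Kato2004Asterisque, proof of Prop. 14.16 (pp. 244–245)] -/
theorem cupProduct_descend_eq_zero_of_mem_ker_map_primaryInclusion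
    (hj : ∀ τ : (W.baseChange E).toAffine.Point, (∃ a : ℕ, p ^ a • τ = 0) → p ^ j • τ = 0)
    {z : galoisCohomology (GaloisRep.restrictField E (W.torsionGaloisModule ((p ^ k : ℕ) : ℤ))) 1}
    (hz : z ∈ (galoisCohomology.map ((primaryInclusion W p k).restrictField E) 1).ker)
    (y : galoisCohomology (GaloisRep.restrictField E (W.torsionGaloisModule ((p ^ j * p ^ k : ℕ) : ℤ))) 1) :
    haveI := neZero_pow p j; haveI := neZero_pow p k
    (pairing (GaloisRep.restrictField E (W.torsionGaloisModule ((p ^ k : ℕ) : ℤ)))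
        (GaloisRep.restrictField E (W.torsionGaloisModule ((p ^ k : ℕ) : ℤ)))
        (GaloisRep.restrictField E (mu K (p ^ j * p ^ k))) (descendHom W (p ^ j) (p ^ k) e hμ hadd₁ hadd₂)
        (fun σ S T => descendHom_smul W (p ^ j) (p ^ k) e hμ hadd₁ hadd₂ hgal (absGaloisRestrict K E σ) S T)).cupProduct z
        (galoisCohomology.map ((mulK W (p ^ j) (p ^ k)).restrictField E) 1 y) = 0 := by
  haveI := neZero_pow p j; haveI := neZero_pow p k
  have hp : p.Prime := Fact.out
  have hn : ((p ^ k : ℕ) : ℤ) ≠ 0 := Int.natCast_ne_zero.mpr (pow_ne_zero k hp.ne_zero)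
  -- `z = κ(t)` with `t` torsion, `t = τ + p^k • R`, `p^a τ = 0`
  rw [← map_torsion_localKummerMap_eq_ker_map_primaryInclusion W p k E hn] at hz
  obtain ⟨t, ht, rfl⟩ := hz
  obtain ⟨τ, R, a, hτ, rfl⟩ := exists_ppow_torsion_add_nsmul_of_isOfFinAddOrder p k
    ((AddCommGroup.mem_torsion _).mp ht)
  have h0 : W.localKummerMap E hn (p ^ k • R) = 0 := by
    rw [← AddMonoidHom.mem_ker, W.ker_localKummerMap E hn]
    exact ⟨R, by rw [zsmulAddGroupHom_apply, natCast_zsmul]⟩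
  rw [map_add, h0, add_zero]
  -- `κ(τ) = κ_{E,p^k}(Q)` with `Q` the chosen root: `(p^j p^k) Q = p^j τ = 0`
  have hjτ : p ^ j • τ = 0 := hj τ ⟨a, hτ⟩
  have hkd : ((p ^ j * p ^ k : ℕ) : ℤ) • W.localZSMulRoot E hn τ = 0 := by
    rw [Nat.cast_mul, mul_smul, W.zsmul_localZSMulRoot E hn τ, natCast_zsmul, ← map_nsmul, ← map_nsmul, hjτ, map_zero,
      map_zero]
  exact cupProduct_descend_restrictField_localKummerClass_map_mulK_eq_zero W (p ^ j) (p ^ k) E e hμ hadd₁ hadd₂ hgal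
    (W.localZSMulRoot E hn τ) (W.zsmul_mem_fixedPoints_of_eq E (W.zsmul_localZSMulRoot E hn τ)) hkd y

end Field

/-! ## §3 At a finite place of a number field: `ker ι_k ≤ {}^⊥Y` for every `Y ≤ (desc^♭)_* [p^j]_* H¹(K_v, E[p^j p^k])` -/

section NumberField

variable {K : Type u} [Field K] [NumberField K] (W : WeierstrassCurve K) [W.IsElliptic] (p k j : ℕ) [Fact p.Prime]
  (v : HeightOneSpectrum (𝓞 K))
  (e : geomTorsion W ((p ^ j * p ^ k : ℕ) : ℤ) → geomTorsion W ((p ^ j * p ^ k : ℕ) : ℤ) → AlgebraicClosure K)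
  (hμ : ∀ S T, e S T ^ (p ^ j * p ^ k) = 1)
  (hadd₁ : ∀ S₁ S₂ T, e (S₁ + S₂) T = e S₁ T * e S₂ T)
  (hadd₂ : ∀ S T₁ T₂, e S (T₁ + T₂) = e S T₁ * e S T₂)
  (hgal : ∀ (σ : absoluteGaloisGroup K) (S T : geomTorsion W ((p ^ j * p ^ k : ℕ) : ℤ)), σ • e S T = e (σ • S) (σ • T))
  -- `E[p^k]` is finite (tree `finite_geomTorsion_of_neZero`, X11b `finite_geomTorsion_pow`); carried as an instance hypothesis so
  -- that no local instance is declared in this file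
  [Finite (geomTorsion W ((p ^ k : ℕ) : ℤ))]

/-- **`⟨z, (desc^♭)_* [p^j]_* ỹ⟩_v = 0`** at a finite place `v` of a number field, for every `z ∈ ker(H¹(K_v, E[p^k]) → H¹(K_v, E[p^∞]))`,
every `ỹ ∈ H¹(K_v, E[p^j p^k])` and ANY additive `inv_v : H²(K_v, μ_{p^j p^k}) → ℤ/(p^j p^k)`, provided `p^j` kills the `p`-power
torsion of `E(K_v)` (e.g. `p^j ≥ #E(K_v)[p^∞]`): §1 (L1-translation for the descended pairing) + §2.
[cite: MilneADT2006, Ch. I §6, proof of Prop. 6.9] [cite: Kato2004Asterisque, proof of Prop. 14.16 (pp. 244–245)] -/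
theorem localTatePairingZMod_eq_zero_of_mem_ker_map_primaryInclusion
    (hj : ∀ τ : (W.baseChange (v.adicCompletion K)).toAffine.Point, (∃ a : ℕ, p ^ a • τ = 0) → p ^ j • τ = 0)
    (inv : galoisCohomology ((mu K (p ^ j * p ^ k)).toLocal (Sum.inr v)) 2 →+ ZMod (p ^ j * p ^ k))
    {z : galoisCohomology ((W.torsionGaloisModule ((p ^ k : ℕ) : ℤ)).toLocal (Sum.inr v)) 1}
    (hz : z ∈ (galoisCohomology.map ((primaryInclusion W p k).restrictField (v.adicCompletion K)) 1).ker)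
    (y : galoisCohomology ((W.torsionGaloisModule ((p ^ j * p ^ k : ℕ) : ℤ)).toLocal (Sum.inr v)) 1) :
    haveI := neZero_pow p j; haveI := neZero_pow p k
    localTatePairingZMod (W.torsionGaloisModule ((p ^ k : ℕ) : ℤ)) (p ^ j * p ^ k) (Sum.inr v) inv z
      (galoisCohomology.map ((DiscreteGaloisModule.pairingDualIntertwining
          (ρ₁ := W.torsionGaloisModule ((p ^ k : ℕ) : ℤ)) (ρ₂ := W.torsionGaloisModule ((p ^ k : ℕ) : ℤ))
          (B := descendHom W (p ^ j) (p ^ k) e hμ hadd₁ hadd₂)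
          (descendHom_smul W (p ^ j) (p ^ k) e hμ hadd₁ hadd₂ hgal)).restrictField
          (Place.Completion (Sum.inr v : Place K))) 1
        (galoisCohomology.map ((mulK W (p ^ j) (p ^ k)).restrictField (Place.Completion (Sum.inr v : Place K))) 1 y)) = 0 := by
  haveI := neZero_pow p j; haveI := neZero_pow p k
  haveI : CharZero (v.adicCompletion K) := charZero_adicCompletion v
  haveI : CharZero (Place.Completion (Sum.inr v : Place K)) := charZero_adicCompletion v
  rw [localTatePairingZMod_map_pairingDualIntertwining]
  have h := cupProduct_descend_eq_zero_of_mem_ker_map_primaryInclusion W p k j (v.adicCompletion K) e hμ hadd₁ hadd₂ hgal hj hz y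
  exact (congrArg inv h).trans (map_zero inv)

/-- **`ker ι_k ≤ {}^⊥Y`**: the kernel of `H¹(K_v, E[p^k]) → H¹(K_v, E[p^∞])` is annihilated, under the local Tate pairing
`⟨·,·⟩_v = inv_v(· ∪_{ev} ·)`, by every subgroup `Y ≤ H¹(K_v, E[p^k]^D)` all of whose elements are transports `(desc^♭)_* [p^j]_* ỹ` of
classes coming down from level `p^j p^k` (e.g. `Y = B_k = loc_v (desc^♭)_* red_{p^k}(A)`, by the `j`-step tower of part 29), provided `p^j`
kills the `p`-power torsion of `E(K_v)`. [cite: MilneADT2006, Ch. I §6, proof of Prop. 6.9] [cite: Kato2004Asterisque, proof of Prop. 14.16 (pp. 244–245)] -/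
theorem ker_map_primaryInclusion_le_annLeft
    (hj : ∀ τ : (W.baseChange (v.adicCompletion K)).toAffine.Point, (∃ a : ℕ, p ^ a • τ = 0) → p ^ j • τ = 0)
    (inv : galoisCohomology ((mu K (p ^ j * p ^ k)).toLocal (Sum.inr v)) 2 →+ ZMod (p ^ j * p ^ k))
    (Y : AddSubgroup (galoisCohomology
      (((W.torsionGaloisModule ((p ^ k : ℕ) : ℤ)).tateDual (p ^ j * p ^ k)).toLocal (Sum.inr v)) 1))
    (hY : haveI := neZero_pow p j; haveI := neZero_pow p k
      ∀ y ∈ Y, ∃ y' : galoisCohomology ((W.torsionGaloisModule ((p ^ j * p ^ k : ℕ) : ℤ)).toLocal (Sum.inr v)) 1,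
        y = galoisCohomology.map ((DiscreteGaloisModule.pairingDualIntertwining
          (ρ₁ := W.torsionGaloisModule ((p ^ k : ℕ) : ℤ)) (ρ₂ := W.torsionGaloisModule ((p ^ k : ℕ) : ℤ))
          (B := descendHom W (p ^ j) (p ^ k) e hμ hadd₁ hadd₂)
          (descendHom_smul W (p ^ j) (p ^ k) e hμ hadd₁ hadd₂ hgal)).restrictField
          (Place.Completion (Sum.inr v : Place K))) 1
        (galoisCohomology.map ((mulK W (p ^ j) (p ^ k)).restrictField (Place.Completion (Sum.inr v : Place K))) 1 y')) :
    (galoisCohomology.map ((primaryInclusion W p k).restrictField (v.adicCompletion K)) 1).ker ≤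
      annLeft (localTatePairingZMod (W.torsionGaloisModule ((p ^ k : ℕ) : ℤ)) (p ^ j * p ^ k) (Sum.inr v) inv) Y := by
  intro z hz y hy
  obtain ⟨y', rfl⟩ := hY y hy
  exact localTatePairingZMod_eq_zero_of_mem_ker_map_primaryInclusion W p k j v e hμ hadd₁ hadd₂ hgal hj inv hz y'

/-- **`ker ι_k ≤ 𝓚_v ⊓ {}^⊥Y`** — the hypothesis `hZ` of brick (a)'s count (part 32 `natCard_mul_relIndex_mul_relIndex_eq_natCard` with
`Z = ker ι_k`, `𝓚 = ` the local Kummer condition, `Y` as above): `ker ι_k ≤ 𝓚_v` is X11b's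
`ker_map_primaryInclusion_le_kummerLocalConditionAt`, `ker ι_k ≤ {}^⊥Y` is `ker_map_primaryInclusion_le_annLeft`.
[cite: Kato2004Asterisque, proof of Prop. 14.16 (pp. 244–245)] [cite: GreenbergLNM1716, §5 proof of Prop. 5.8] -/
theorem ker_map_primaryInclusion_le_kummer_inf_annLeft
    (hj : ∀ τ : (W.baseChange (v.adicCompletion K)).toAffine.Point, (∃ a : ℕ, p ^ a • τ = 0) → p ^ j • τ = 0)
    (inv : galoisCohomology ((mu K (p ^ j * p ^ k)).toLocal (Sum.inr v)) 2 →+ ZMod (p ^ j * p ^ k))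
    (Y : AddSubgroup (galoisCohomology
      (((W.torsionGaloisModule ((p ^ k : ℕ) : ℤ)).tateDual (p ^ j * p ^ k)).toLocal (Sum.inr v)) 1))
    (hY : haveI := neZero_pow p j; haveI := neZero_pow p k
      ∀ y ∈ Y, ∃ y' : galoisCohomology ((W.torsionGaloisModule ((p ^ j * p ^ k : ℕ) : ℤ)).toLocal (Sum.inr v)) 1,
        y = galoisCohomology.map ((DiscreteGaloisModule.pairingDualIntertwining
          (ρ₁ := W.torsionGaloisModule ((p ^ k : ℕ) : ℤ)) (ρ₂ := W.torsionGaloisModule ((p ^ k : ℕ) : ℤ))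
          (B := descendHom W (p ^ j) (p ^ k) e hμ hadd₁ hadd₂)
          (descendHom_smul W (p ^ j) (p ^ k) e hμ hadd₁ hadd₂ hgal)).restrictField
          (Place.Completion (Sum.inr v : Place K))) 1
        (galoisCohomology.map ((mulK W (p ^ j) (p ^ k)).restrictField (Place.Completion (Sum.inr v : Place K))) 1 y')) :
    (galoisCohomology.map ((primaryInclusion W p k).restrictField (v.adicCompletion K)) 1).ker ≤
      W.kummerSelmerStructure ((p ^ k : ℕ) : ℤ) (Sum.inr v) ⊓
        annLeft (localTatePairingZMod (W.torsionGaloisModule ((p ^ k : ℕ) : ℤ)) (p ^ j * p ^ k) (Sum.inr v) inv) Y :=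
  le_inf (ker_map_primaryInclusion_le_kummerLocalConditionAt W p k _)
    (ker_map_primaryInclusion_le_annLeft W p k j v e hμ hadd₁ hadd₂ hgal hj inv Y hY)

end NumberField

end Summit.BirchSwinnertonDyer.BirchSwinnertonDyer.Theorems.KummerTowerOrthogonal

end
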